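import Literature.NumberTheory.LFunctions.FeketePolyaKernelCertificatesResidueTables
import HarnessLib

/-!
# Fekete–Pólya certificates for large conductors: the per-conductor wrappers over residue tables

Topic `Literature/NumberTheory/LFunctions`; namespace `Literature.NumberTheory.LFunctions.FeketePolyaKernel`
(sequel of `FeketePolyaKernelCertificatesResidueTables.lean`). THEOREMS only (no definition, no named fact, no
`sorry`): for each conductor shape (`q` odd, `4m`, `8m`; `q`, `m` given as a list `ps` of odd primes — primality
by `norm_num`, the product by `decide` at the call site) and each parity, the statement of the `interval_cases`
bullets of the `NoRealZero{Odd,Even}…` range files — every primitive quadratic `χ` mod `q` of that parity has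
`L(σ, χ) ≠ 0` on `(0, 1)` — from EITHER the parity test (`χ(−1)` read off the value function: no such character)
OR a kernel certificate with values from the residue table `resTable ps`:
* `good_{odd,even}_of_{odd,four,eight}_r2` — ORDER TWO along `χ↑(q·w)`: `runOK (val…R (resTable ps)) (q·w)`
  (engine `lfunction_ne_zero_of_check` of `FeketePolyaKernelCertificates.lean`; `≈ 0.45 ms` of kernel time per
  step at `q ≈ 10⁴–2·10⁴`, measured);
* `good_{odd,even}_of_{odd,four,eight}_fpR` — ORDER `k ≤ 12` along `χ↑(q·w)`: `fpRun (val…R (resTable ps)) q w k`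
  (engine `lfunction_ne_zero_of_fpRun` of `FeketePolyaKernelCertificatesHigherOrder.lean`; `≈ 0.9 ms` per step
  at order `4`, `≈ 1.3 ms` at order `12`).
Cell `parity-realchar`, kernel floor of the wide column, Fekete–Pólya lane (seat prover-2).

## References

* H. L. Montgomery, R. C. Vaughan, *Multiplicative Number Theory I*, CUP 2007, §9.3 Thm 9.13, §11.2.1
  Exercises 7–8. [MontgomeryVaughan2007]
* M. Fekete, G. Pólya, *Über ein Problem von Laguerre*, Rend. Circ. Mat. Palermo 34 (1912) 89–120. [FeketePolya1912]
-/

namespace Literature.NumberTheory.LFunctions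

namespace FeketePolyaKernel

open Literature.Barriers.RiemannHypothesis PrimitiveQuadratic FeketePolyaTable SmallModuli OddSmallModuliII
open scoped NumberTheorySymbols

/-- A product of odd numbers is odd. [folklore] -/
private theorem prod_mod_two' : ∀ (ps : List ℕ), (∀ p ∈ ps, p % 2 = 1) → ps.prod % 2 = 1
  | [], _ => rfl
  | p :: rest, h => by
    rw [List.prod_cons, Nat.mul_mod, h p (by simp), prod_mod_two' rest fun p' hp' ↦ h p' (by simp [hp'])]

/-- All entries of the factor list are odd. [folklore] -/
private theorem odd_of_forall {ps : List ℕ} (hps : ps.Forall fun p ↦ p.Prime ∧ p ≠ 2) : ∀ p ∈ ps, p % 2 = 1 := by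
  rw [List.forall_iff_forall_mem] at hps
  exact fun p hp ↦ (hps p hp).1.eq_two_or_odd.resolve_left (hps p hp).2

/-! ### Per-conductor wrappers keyed on `q` and a factor list (parity test or certificate) -/

/-- Primitive characters of modulus `≥ 2` are non-trivial. [folklore] -/
private theorem ne_one'' {q : ℕ} [NeZero q] {χ : DirichletCharacter ℂ q} (hprim : χ.IsPrimitive)
    (hq : 2 ≤ q) : χ ≠ 1 :=
  SiegelZeroQuality.ne_one_of_isPrimitive hprim hq

/-- **Odd characters, odd conductor `q = ∏ ps > 1`**: parity test or certificate, values from the residue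
table of the factor list `ps`. [cite: MontgomeryVaughan2007, §11.2.1 Exercises 7 (g), 8] -/
theorem good_odd_of_odd_fpR {q : ℕ} [NeZero q] (ps : List ℕ) (hps : ps.Forall fun p ↦ p.Prime ∧ p ≠ 2)
    (hprod : ps.prod = q) (hq1 : 1 < q) (w k : ℕ) (hw : w ≠ 0)
    (h : valOddR (resTable ps) (q - 1) = 1 ∨ fpRun (valOddR (resTable ps)) q w k = true) :
    ∀ χ : DirichletCharacter ℂ q, χ.IsQuadratic → χ.IsPrimitive → χ.Odd →
      ∀ σ : ℝ, 0 < σ → σ < 1 → χ.LFunction σ ≠ 0 := by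
  have hq2 : q % 2 = 1 := hprod ▸ prod_mod_two' ps (odd_of_forall hps)
  intro χ hquad hprim hodd σ hσ _
  have hv : ∀ n : ℕ, (χ (n : ZMod q)).re = valOddR (resTable ps) n := fun n ↦ by
    rw [valOddR_eq hps hprod hq1, re_apply_eq_valOdd (Nat.odd_iff.mpr hq2) hq1 hprim hquad]
  rcases h with hpar | hrun
  · exact (not_odd_of_val _ hv hpar hodd).elim
  · exact lfunction_ne_zero_of_fpRun χ (ne_one'' hprim hq1) hquad _ hv hw hrun hσ

/-- **Even characters, odd conductor**: parity test or certificate. [cite: MontgomeryVaughan2007, §11.2.1 Exercises 7 (g), 8] -/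
theorem good_even_of_odd_fpR {q : ℕ} [NeZero q] (ps : List ℕ) (hps : ps.Forall fun p ↦ p.Prime ∧ p ≠ 2)
    (hprod : ps.prod = q) (hq1 : 1 < q) (w k : ℕ) (hw : w ≠ 0)
    (h : valOddR (resTable ps) (q - 1) = -1 ∨ fpRun (valOddR (resTable ps)) q w k = true) :
    ∀ χ : DirichletCharacter ℂ q, χ.IsQuadratic → χ.IsPrimitive → χ.Even →
      ∀ σ : ℝ, 0 < σ → σ < 1 → χ.LFunction σ ≠ 0 := by
  have hq2 : q % 2 = 1 := hprod ▸ prod_mod_two' ps (odd_of_forall hps)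
  intro χ hquad hprim heven σ hσ _
  have hv : ∀ n : ℕ, (χ (n : ZMod q)).re = valOddR (resTable ps) n := fun n ↦ by
    rw [valOddR_eq hps hprod hq1, re_apply_eq_valOdd (Nat.odd_iff.mpr hq2) hq1 hprim hquad]
  rcases h with hpar | hrun
  · exact (not_even_of_val _ hv hpar heven).elim
  · exact lfunction_ne_zero_of_fpRun χ (ne_one'' hprim hq1) hquad _ hv hw hrun hσ

/-- **Odd characters, conductor `4m`, `m = ∏ ps > 1`**: parity test or certificate.
[cite: MontgomeryVaughan2007, §11.2.1 Exercises 7 (g), 8] -/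
theorem good_odd_of_four_fpR {q : ℕ} [NeZero q] (ps : List ℕ) (hps : ps.Forall fun p ↦ p.Prime ∧ p ≠ 2)
    (hprod : 4 * ps.prod = q) (hq1 : 4 < q) (w k : ℕ) (hw : w ≠ 0)
    (h : valFourR (resTable ps) (q - 1) = 1 ∨ fpRun (valFourR (resTable ps)) q w k = true) :
    ∀ χ : DirichletCharacter ℂ q, χ.IsQuadratic → χ.IsPrimitive → χ.Odd →
      ∀ σ : ℝ, 0 < σ → σ < 1 → χ.LFunction σ ≠ 0 := by
  subst hprod
  set m := ps.prod with hm
  haveI : NeZero m := ⟨by omega⟩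
  have hm2 : m % 2 = 1 := prod_mod_two' ps (odd_of_forall hps)
  intro χ hquad hprim hodd σ hσ _
  have hv : ∀ n : ℕ, (χ (n : ZMod (2 ^ 2 * m))).re = valFourR (resTable ps) n := fun n ↦ by
    rw [valFourR_eq hps hm.symm (by omega), re_apply_eq_valFour (m := m) (Nat.odd_iff.mpr hm2) (by omega)
      hprim hquad]
  rcases h with hpar | hrun
  · exact (not_odd_of_val _ hv hpar hodd).elim
  · exact lfunction_ne_zero_of_fpRun χ (ne_one'' hprim (by omega)) hquad _ hv hw hrun hσ

/-- **Even characters, conductor `4m`**: parity test or certificate. [cite: MontgomeryVaughan2007, §11.2.1 Exercises 7 (g), 8] -/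
theorem good_even_of_four_fpR {q : ℕ} [NeZero q] (ps : List ℕ) (hps : ps.Forall fun p ↦ p.Prime ∧ p ≠ 2)
    (hprod : 4 * ps.prod = q) (hq1 : 4 < q) (w k : ℕ) (hw : w ≠ 0)
    (h : valFourR (resTable ps) (q - 1) = -1 ∨ fpRun (valFourR (resTable ps)) q w k = true) :
    ∀ χ : DirichletCharacter ℂ q, χ.IsQuadratic → χ.IsPrimitive → χ.Even →
      ∀ σ : ℝ, 0 < σ → σ < 1 → χ.LFunction σ ≠ 0 := by
  subst hprod
  set m := ps.prod with hm
  haveI : NeZero m := ⟨by omega⟩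
  have hm2 : m % 2 = 1 := prod_mod_two' ps (odd_of_forall hps)
  intro χ hquad hprim heven σ hσ _
  have hv : ∀ n : ℕ, (χ (n : ZMod (2 ^ 2 * m))).re = valFourR (resTable ps) n := fun n ↦ by
    rw [valFourR_eq hps hm.symm (by omega), re_apply_eq_valFour (m := m) (Nat.odd_iff.mpr hm2) (by omega)
      hprim hquad]
  rcases h with hpar | hrun
  · exact (not_even_of_val _ hv hpar heven).elim
  · exact lfunction_ne_zero_of_fpRun χ (ne_one'' hprim (by omega)) hquad _ hv hw hrun hσ

/-- **Odd characters, conductor `8m`, `m = ∏ ps > 1`** (two value patterns): for each, parity test or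
certificate. [cite: MontgomeryVaughan2007, §11.2.1 Exercises 7 (g), 8] -/
theorem good_odd_of_eight_fpR {q : ℕ} [NeZero q] (ps : List ℕ) (hps : ps.Forall fun p ↦ p.Prime ∧ p ≠ 2)
    (hprod : 8 * ps.prod = q) (hq1 : 8 < q) (w k : ℕ) (hw : w ≠ 0)
    (hA : valEightAR (resTable ps) (q - 1) = 1 ∨ fpRun (valEightAR (resTable ps)) q w k = true)
    (hB : valEightBR (resTable ps) (q - 1) = 1 ∨ fpRun (valEightBR (resTable ps)) q w k = true) :
    ∀ χ : DirichletCharacter ℂ q, χ.IsQuadratic → χ.IsPrimitive → χ.Odd →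
      ∀ σ : ℝ, 0 < σ → σ < 1 → χ.LFunction σ ≠ 0 := by
  subst hprod
  set m := ps.prod with hm
  haveI : NeZero m := ⟨by omega⟩
  have hm2 : m % 2 = 1 := prod_mod_two' ps (odd_of_forall hps)
  intro χ hquad hprim hodd σ hσ _
  rcases re_apply_eq_valEight (m := m) (Nat.odd_iff.mpr hm2) (by omega) hprim hquad with hv | hv
  · replace hv : ∀ n : ℕ, (χ (n : ZMod (2 ^ 3 * m))).re = valEightAR (resTable ps) n := fun n ↦ by
      rw [valEightAR_eq hps hm.symm (by omega), hv]
    rcases hA with hpar | hrun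
    · exact (not_odd_of_val _ hv hpar hodd).elim
    · exact lfunction_ne_zero_of_fpRun χ (ne_one'' hprim (by omega)) hquad _ hv hw hrun hσ
  · replace hv : ∀ n : ℕ, (χ (n : ZMod (2 ^ 3 * m))).re = valEightBR (resTable ps) n := fun n ↦ by
      rw [valEightBR_eq hps hm.symm (by omega), hv]
    rcases hB with hpar | hrun
    · exact (not_odd_of_val _ hv hpar hodd).elim
    · exact lfunction_ne_zero_of_fpRun χ (ne_one'' hprim (by omega)) hquad _ hv hw hrun hσ

/-- **Even characters, conductor `8m`**: for each value pattern, parity test or certificate.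
[cite: MontgomeryVaughan2007, §11.2.1 Exercises 7 (g), 8] -/
theorem good_even_of_eight_fpR {q : ℕ} [NeZero q] (ps : List ℕ) (hps : ps.Forall fun p ↦ p.Prime ∧ p ≠ 2)
    (hprod : 8 * ps.prod = q) (hq1 : 8 < q) (w k : ℕ) (hw : w ≠ 0)
    (hA : valEightAR (resTable ps) (q - 1) = -1 ∨ fpRun (valEightAR (resTable ps)) q w k = true)
    (hB : valEightBR (resTable ps) (q - 1) = -1 ∨ fpRun (valEightBR (resTable ps)) q w k = true) :
    ∀ χ : DirichletCharacter ℂ q, χ.IsQuadratic → χ.IsPrimitive → χ.Even →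
      ∀ σ : ℝ, 0 < σ → σ < 1 → χ.LFunction σ ≠ 0 := by
  subst hprod
  set m := ps.prod with hm
  haveI : NeZero m := ⟨by omega⟩
  have hm2 : m % 2 = 1 := prod_mod_two' ps (odd_of_forall hps)
  intro χ hquad hprim heven σ hσ _
  rcases re_apply_eq_valEight (m := m) (Nat.odd_iff.mpr hm2) (by omega) hprim hquad with hv | hv
  · replace hv : ∀ n : ℕ, (χ (n : ZMod (2 ^ 3 * m))).re = valEightAR (resTable ps) n := fun n ↦ by
      rw [valEightAR_eq hps hm.symm (by omega), hv]
    rcases hA with hpar | hrun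
    · exact (not_even_of_val _ hv hpar heven).elim
    · exact lfunction_ne_zero_of_fpRun χ (ne_one'' hprim (by omega)) hquad _ hv hw hrun hσ
  · replace hv : ∀ n : ℕ, (χ (n : ZMod (2 ^ 3 * m))).re = valEightBR (resTable ps) n := fun n ↦ by
      rw [valEightBR_eq hps hm.symm (by omega), hv]
    rcases hB with hpar | hrun
    · exact (not_even_of_val _ hv hpar heven).elim
    · exact lfunction_ne_zero_of_fpRun χ (ne_one'' hprim (by omega)) hquad _ hv hw hrun hσ

/-! ### Order two along `χ↑(q·w)` with residue-table values (the engine `runOK` of the first file) -/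

/-- **Odd characters, odd conductor, ORDER TWO** along `χ↑(q·w)`: parity test or `runOK (valOddR …) (q·w)`.
[cite: MontgomeryVaughan2007, §11.2.1 Exercises 7 (g), 8] -/
theorem good_odd_of_odd_r2 {q : ℕ} [NeZero q] (ps : List ℕ) (hps : ps.Forall fun p ↦ p.Prime ∧ p ≠ 2)
    (hprod : ps.prod = q) (hq1 : 1 < q) (w : ℕ) (hw : w ≠ 0)
    (h : valOddR (resTable ps) (q - 1) = 1 ∨ runOK (valOddR (resTable ps)) (q * w) = true) :
    ∀ χ : DirichletCharacter ℂ q, χ.IsQuadratic → χ.IsPrimitive → χ.Odd →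
      ∀ σ : ℝ, 0 < σ → σ < 1 → χ.LFunction σ ≠ 0 := by
  have hq2 : q % 2 = 1 := hprod ▸ prod_mod_two' ps (odd_of_forall hps)
  haveI : NeZero (q * w) := ⟨Nat.mul_ne_zero (NeZero.ne q) hw⟩
  intro χ hquad hprim hodd σ hσ _
  have hv : ∀ n : ℕ, (χ (n : ZMod q)).re = valOddR (resTable ps) n := fun n ↦ by
    rw [valOddR_eq hps hprod hq1, re_apply_eq_valOdd (Nat.odd_iff.mpr hq2) hq1 hprim hquad]
  rcases h with hpar | hrun
  · exact (not_odd_of_val _ hv hpar hodd).elim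
  · exact lfunction_ne_zero_of_check (dvd_mul_right q w) χ _ hv (ne_one'' hprim hq1) (check_of_runOK hrun) hσ

/-- **Even characters, odd conductor, order two**: parity test or `runOK`. [cite: MontgomeryVaughan2007, §11.2.1 Exercises 7 (g), 8] -/
theorem good_even_of_odd_r2 {q : ℕ} [NeZero q] (ps : List ℕ) (hps : ps.Forall fun p ↦ p.Prime ∧ p ≠ 2)
    (hprod : ps.prod = q) (hq1 : 1 < q) (w : ℕ) (hw : w ≠ 0)
    (h : valOddR (resTable ps) (q - 1) = -1 ∨ runOK (valOddR (resTable ps)) (q * w) = true) :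
    ∀ χ : DirichletCharacter ℂ q, χ.IsQuadratic → χ.IsPrimitive → χ.Even →
      ∀ σ : ℝ, 0 < σ → σ < 1 → χ.LFunction σ ≠ 0 := by
  have hq2 : q % 2 = 1 := hprod ▸ prod_mod_two' ps (odd_of_forall hps)
  haveI : NeZero (q * w) := ⟨Nat.mul_ne_zero (NeZero.ne q) hw⟩
  intro χ hquad hprim heven σ hσ _
  have hv : ∀ n : ℕ, (χ (n : ZMod q)).re = valOddR (resTable ps) n := fun n ↦ by
    rw [valOddR_eq hps hprod hq1, re_apply_eq_valOdd (Nat.odd_iff.mpr hq2) hq1 hprim hquad]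
  rcases h with hpar | hrun
  · exact (not_even_of_val _ hv hpar heven).elim
  · exact lfunction_ne_zero_of_check (dvd_mul_right q w) χ _ hv (ne_one'' hprim hq1) (check_of_runOK hrun) hσ

/-- **Odd characters, conductor `4m`, order two**: parity test or `runOK`. [cite: MontgomeryVaughan2007, §11.2.1 Exercises 7 (g), 8] -/
theorem good_odd_of_four_r2 {q : ℕ} [NeZero q] (ps : List ℕ) (hps : ps.Forall fun p ↦ p.Prime ∧ p ≠ 2)
    (hprod : 4 * ps.prod = q) (hq1 : 4 < q) (w : ℕ) (hw : w ≠ 0)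
    (h : valFourR (resTable ps) (q - 1) = 1 ∨ runOK (valFourR (resTable ps)) (q * w) = true) :
    ∀ χ : DirichletCharacter ℂ q, χ.IsQuadratic → χ.IsPrimitive → χ.Odd →
      ∀ σ : ℝ, 0 < σ → σ < 1 → χ.LFunction σ ≠ 0 := by
  subst hprod
  set m := ps.prod with hm
  haveI : NeZero m := ⟨by omega⟩
  haveI : NeZero (4 * m * w) := ⟨Nat.mul_ne_zero (by omega) hw⟩
  have hm2 : m % 2 = 1 := prod_mod_two' ps (odd_of_forall hps)
  intro χ hquad hprim hodd σ hσ _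
  have hv : ∀ n : ℕ, (χ (n : ZMod (2 ^ 2 * m))).re = valFourR (resTable ps) n := fun n ↦ by
    rw [valFourR_eq hps hm.symm (by omega), re_apply_eq_valFour (m := m) (Nat.odd_iff.mpr hm2) (by omega)
      hprim hquad]
  rcases h with hpar | hrun
  · exact (not_odd_of_val _ hv hpar hodd).elim
  · exact lfunction_ne_zero_of_check (dvd_mul_right _ w) χ _ hv (ne_one'' hprim (by omega))
      (check_of_runOK hrun) hσ

/-- **Even characters, conductor `4m`, order two**: parity test or `runOK`. [cite: MontgomeryVaughan2007, §11.2.1 Exercises 7 (g), 8] -/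
theorem good_even_of_four_r2 {q : ℕ} [NeZero q] (ps : List ℕ) (hps : ps.Forall fun p ↦ p.Prime ∧ p ≠ 2)
    (hprod : 4 * ps.prod = q) (hq1 : 4 < q) (w : ℕ) (hw : w ≠ 0)
    (h : valFourR (resTable ps) (q - 1) = -1 ∨ runOK (valFourR (resTable ps)) (q * w) = true) :
    ∀ χ : DirichletCharacter ℂ q, χ.IsQuadratic → χ.IsPrimitive → χ.Even →
      ∀ σ : ℝ, 0 < σ → σ < 1 → χ.LFunction σ ≠ 0 := by
  subst hprod
  set m := ps.prod with hm
  haveI : NeZero m := ⟨by omega⟩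
  haveI : NeZero (4 * m * w) := ⟨Nat.mul_ne_zero (by omega) hw⟩
  have hm2 : m % 2 = 1 := prod_mod_two' ps (odd_of_forall hps)
  intro χ hquad hprim heven σ hσ _
  have hv : ∀ n : ℕ, (χ (n : ZMod (2 ^ 2 * m))).re = valFourR (resTable ps) n := fun n ↦ by
    rw [valFourR_eq hps hm.symm (by omega), re_apply_eq_valFour (m := m) (Nat.odd_iff.mpr hm2) (by omega)
      hprim hquad]
  rcases h with hpar | hrun
  · exact (not_even_of_val _ hv hpar heven).elim
  · exact lfunction_ne_zero_of_check (dvd_mul_right _ w) χ _ hv (ne_one'' hprim (by omega))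
      (check_of_runOK hrun) hσ

/-- **Odd characters, conductor `8m`, order two** (two patterns): parity test or `runOK` each.
[cite: MontgomeryVaughan2007, §11.2.1 Exercises 7 (g), 8] -/
theorem good_odd_of_eight_r2 {q : ℕ} [NeZero q] (ps : List ℕ) (hps : ps.Forall fun p ↦ p.Prime ∧ p ≠ 2)
    (hprod : 8 * ps.prod = q) (hq1 : 8 < q) (w : ℕ) (hw : w ≠ 0)
    (hA : valEightAR (resTable ps) (q - 1) = 1 ∨ runOK (valEightAR (resTable ps)) (q * w) = true)
    (hB : valEightBR (resTable ps) (q - 1) = 1 ∨ runOK (valEightBR (resTable ps)) (q * w) = true) :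
    ∀ χ : DirichletCharacter ℂ q, χ.IsQuadratic → χ.IsPrimitive → χ.Odd →
      ∀ σ : ℝ, 0 < σ → σ < 1 → χ.LFunction σ ≠ 0 := by
  subst hprod
  set m := ps.prod with hm
  haveI : NeZero m := ⟨by omega⟩
  haveI : NeZero (8 * m * w) := ⟨Nat.mul_ne_zero (by omega) hw⟩
  have hm2 : m % 2 = 1 := prod_mod_two' ps (odd_of_forall hps)
  intro χ hquad hprim hodd σ hσ _
  rcases re_apply_eq_valEight (m := m) (Nat.odd_iff.mpr hm2) (by omega) hprim hquad with hv | hv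
  · replace hv : ∀ n : ℕ, (χ (n : ZMod (2 ^ 3 * m))).re = valEightAR (resTable ps) n := fun n ↦ by
      rw [valEightAR_eq hps hm.symm (by omega), hv]
    rcases hA with hpar | hrun
    · exact (not_odd_of_val _ hv hpar hodd).elim
    · exact lfunction_ne_zero_of_check (dvd_mul_right _ w) χ _ hv (ne_one'' hprim (by omega))
        (check_of_runOK hrun) hσ
  · replace hv : ∀ n : ℕ, (χ (n : ZMod (2 ^ 3 * m))).re = valEightBR (resTable ps) n := fun n ↦ by
      rw [valEightBR_eq hps hm.symm (by omega), hv]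
    rcases hB with hpar | hrun
    · exact (not_odd_of_val _ hv hpar hodd).elim
    · exact lfunction_ne_zero_of_check (dvd_mul_right _ w) χ _ hv (ne_one'' hprim (by omega))
        (check_of_runOK hrun) hσ

/-- **Even characters, conductor `8m`, order two**: parity test or `runOK` each.
[cite: MontgomeryVaughan2007, §11.2.1 Exercises 7 (g), 8] -/
theorem good_even_of_eight_r2 {q : ℕ} [NeZero q] (ps : List ℕ) (hps : ps.Forall fun p ↦ p.Prime ∧ p ≠ 2)
    (hprod : 8 * ps.prod = q) (hq1 : 8 < q) (w : ℕ) (hw : w ≠ 0)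
    (hA : valEightAR (resTable ps) (q - 1) = -1 ∨ runOK (valEightAR (resTable ps)) (q * w) = true)
    (hB : valEightBR (resTable ps) (q - 1) = -1 ∨ runOK (valEightBR (resTable ps)) (q * w) = true) :
    ∀ χ : DirichletCharacter ℂ q, χ.IsQuadratic → χ.IsPrimitive → χ.Even →
      ∀ σ : ℝ, 0 < σ → σ < 1 → χ.LFunction σ ≠ 0 := by
  subst hprod
  set m := ps.prod with hm
  haveI : NeZero m := ⟨by omega⟩
  haveI : NeZero (8 * m * w) := ⟨Nat.mul_ne_zero (by omega) hw⟩
  have hm2 : m % 2 = 1 := prod_mod_two' ps (odd_of_forall hps)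
  intro χ hquad hprim heven σ hσ _
  rcases re_apply_eq_valEight (m := m) (Nat.odd_iff.mpr hm2) (by omega) hprim hquad with hv | hv
  · replace hv : ∀ n : ℕ, (χ (n : ZMod (2 ^ 3 * m))).re = valEightAR (resTable ps) n := fun n ↦ by
      rw [valEightAR_eq hps hm.symm (by omega), hv]
    rcases hA with hpar | hrun
    · exact (not_even_of_val _ hv hpar heven).elim
    · exact lfunction_ne_zero_of_check (dvd_mul_right _ w) χ _ hv (ne_one'' hprim (by omega))
        (check_of_runOK hrun) hσ
  · replace hv : ∀ n : ℕ, (χ (n : ZMod (2 ^ 3 * m))).re = valEightBR (resTable ps) n := fun n ↦ by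
      rw [valEightBR_eq hps hm.symm (by omega), hv]
    rcases hB with hpar | hrun
    · exact (not_even_of_val _ hv hpar heven).elim
    · exact lfunction_ne_zero_of_check (dvd_mul_right _ w) χ _ hv (ne_one'' hprim (by omega))
        (check_of_runOK hrun) hσ

end FeketePolyaKernel

end Literature.NumberTheory.LFunctions
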